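import Literature.AlgebraicGeometry.Resolution.LogChartEmbeddedReduction
import Mathlib.RingTheory.Localization.Module
import HarnessLib

/-!
# The rank of the embedded chart monoid (Kato 1994, (2.1): `rank M̄_x^{gp} = n − rk F^{gp}`)

`Literature/AlgebraicGeometry/Resolution/LogChartEmbeddingRank.lean`. The hypothesis `hrank` of
`LogChart.exists_dformData_of_isLogRegularAt` (`LogChartEmbeddedReduction.lean`) — the rank of
the embedded monoid `P′ = e(P) ⊆ ℕ^M` is at most `n − rk_ℤ F^{gp}` — is a piece of linear algebra:
`e` kills `F^{gp}`, so over `ℚ` the image of `ℤⁿ` has dimension `≤ n − rk F^{gp}` (rank–nullity,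
and a `ℤ`-basis of `F^{gp}` stays `ℚ`-independent in `ker e_ℚ`). In Kato's terms this is the
identity `rank (M_x^{gp}/𝒪_x^×) = rank P^{gp} − rank F^{gp}` behind Def. (2.1). PROVED here;
`exists_dformData_of_isLogRegularAt'` is the interface theorem without the rank hypothesis.

References: [Kato1994] K. Kato, Toric singularities, Amer. J. Math. 116 (1994), Def. (2.1), (1.6).
-/

noncomputable section

open IsLocalRing Literature.RingTheory.MvPowerSeries

namespace Literature.AlgebraicGeometry.Resolution

namespace LogChart

universe u

variable {n M : ℕ}

/-- Coordinatewise cast `ℤⁿ → ℚⁿ` as a `ℤ`-linear map. [folklore] -/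
private def castVec (m : ℕ) : (Fin m → ℤ) →ₗ[ℤ] (Fin m → ℚ) where
  toFun v i := (v i : ℚ)
  map_add' v w := by funext i; simp
  map_smul' k v := by funext i; simp

/-- Coordinates of the cast vector. [folklore] -/
private theorem castVec_apply {m : ℕ} (v : Fin m → ℤ) (i : Fin m) : castVec m v i = (v i : ℚ) := rfl

/-- The cast `ℤⁿ → ℚⁿ` is injective. [folklore] -/
private theorem castVec_injective (m : ℕ) : Function.Injective (castVec m) := by
  intro v w h
  funext i
  have := congrFun h i
  rw [castVec_apply, castVec_apply] at this
  exact_mod_cast this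

/-- The `ℚ`-linear extension of an additive map `e : ℤⁿ → ℤ^M`. [folklore] -/
private def ratExt (e : (Fin n → ℤ) →+ (Fin M → ℤ)) : (Fin n → ℚ) →ₗ[ℚ] (Fin M → ℚ) where
  toFun v i := ∑ j, (e (Pi.single j 1) i : ℚ) * v j
  map_add' v w := by funext i; simp only [Pi.add_apply, mul_add, Finset.sum_add_distrib]
  map_smul' q v := by
    funext i
    simp only [Pi.smul_apply, smul_eq_mul, RingHom.id_apply, Finset.mul_sum]
    refine Finset.sum_congr rfl fun j _ => ?_
    ring

/-- `e_ℚ` extends `e`: `e_ℚ (cast v) = cast (e v)`. [folklore] -/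
private theorem ratExt_castVec (e : (Fin n → ℤ) →+ (Fin M → ℤ)) (v : Fin n → ℤ) :
    ratExt e (castVec n v) = castVec M (e v) := by
  have hv : v = ∑ j, v j • (Pi.single j 1 : Fin n → ℤ) := by
    funext i
    simp only [Finset.sum_apply, Pi.smul_apply, Pi.single_apply, smul_eq_mul, mul_ite, mul_one,
      mul_zero, Finset.sum_ite_eq, Finset.mem_univ, if_true]
  funext i
  show ∑ j, (e (Pi.single j 1) i : ℚ) * (v j : ℚ) = ((e v i : ℤ) : ℚ)
  conv_rhs => rw [hv, map_sum]
  rw [Finset.sum_apply]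
  push_cast
  refine Finset.sum_congr rfl fun j _ => ?_
  rw [map_zsmul, Pi.smul_apply, smul_eq_mul, Int.cast_mul, mul_comm]

/-- **The rank bound** `rank e(P) ≤ n − rk_ℤ F^{gp}` for a sharp embedding (indeed for any
additive `e` killing `F`). [cite: Kato1994, Def. (2.1)] -/
theorem rank_embMonoid_le {P F : AddSubmonoid (Fin n → ℤ)} {e : (Fin n → ℤ) →+ (Fin M → ℤ)}
    (he : IsSharpEmbedding P F e) :
    monoidPowerSeries.rank (embMonoid he) ≤
      n - Module.finrank ℤ (Submodule.span ℤ (F : Set (Fin n → ℤ))) := by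
  classical
  set N := Submodule.span ℤ (F : Set (Fin n → ℤ)) with hN
  let E := ratExt e
  -- (1) the span of `P′` lies in the range of `E`
  have h1 : Submodule.span ℚ (monoidPowerSeries.toRatVec '' (embMonoid he : Set (Fin M →₀ ℕ))) ≤
      LinearMap.range E := by
    rw [Submodule.span_le]
    rintro _ ⟨w, hw, rfl⟩
    obtain ⟨p, rfl⟩ := (mem_embMonoid he).1 hw
    refine ⟨castVec n (p : Fin n → ℤ), ?_⟩
    show ratExt e (castVec n (p : Fin n → ℤ)) = _
    rw [ratExt_castVec]
    funext i
    rw [castVec_apply, monoidPowerSeries.toRatVec_apply, ← embHom_apply_coe he p i, Int.cast_natCast]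
  -- (2) a `ℤ`-basis of `N` gives `rk N` independent vectors of `ker E`
  haveI : Module.Finite ℤ N := Module.IsNoetherian.finite ℤ N
  haveI : Module.Free ℤ N := Module.free_of_finite_type_torsion_free'
  let b := Module.finBasis ℤ N
  let w : Fin (Module.finrank ℤ N) → (Fin n → ℚ) := fun k => castVec n (b k : Fin n → ℤ)
  have hwker : ∀ k, w k ∈ LinearMap.ker E := by
    intro k
    rw [LinearMap.mem_ker]
    show ratExt e (castVec n (b k : Fin n → ℤ)) = 0
    rw [ratExt_castVec, he.map_span (b k).2]
    funext i; rw [castVec_apply, Pi.zero_apply, Pi.zero_apply, Int.cast_zero]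
  have hwlinZ : LinearIndependent ℤ w := by
    have hb : LinearIndependent ℤ (fun k => (b k : Fin n → ℤ)) :=
      b.linearIndependent.map' N.subtype (Submodule.ker_subtype N)
    exact hb.map' (castVec n) (LinearMap.ker_eq_bot.2 (castVec_injective n))
  have hwlin : LinearIndependent ℚ w := (LinearIndependent.iff_fractionRing (R := ℤ) (K := ℚ)).1 hwlinZ
  have hwlin' : LinearIndependent ℚ (fun k => (⟨w k, hwker k⟩ : LinearMap.ker E)) :=
    LinearIndependent.of_comp (LinearMap.ker E).subtype (by exact hwlin)
  have h2 : Module.finrank ℤ N ≤ Module.finrank ℚ (LinearMap.ker E) := by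
    simpa using hwlin'.fintype_card_le_finrank
  -- (3) rank–nullity for `E`
  have h3 := LinearMap.finrank_range_add_finrank_ker E
  rw [Module.finrank_fin_fun] at h3
  have h4 : Module.finrank ℚ
      (Submodule.span ℚ (monoidPowerSeries.toRatVec '' (embMonoid he : Set (Fin M →₀ ℕ)))) ≤
      Module.finrank ℚ (LinearMap.range E) := Submodule.finrank_mono h1
  unfold monoidPowerSeries.rank
  omega

/-- **Log regularity in d-form over `A_𝔭`, rank hypothesis discharged**: as
`exists_dformData_of_isLogRegularAt`, for any sharp embedding. [cite: Kato1994, Def. (2.1)] -/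
theorem exists_dformData_of_isLogRegularAt' {A : Type u} [CommRing A]
    {P : AddSubmonoid (Fin n → ℤ)} (hP : P.FG)
    (hsat : ∀ (v : Fin n → ℤ) (k : ℕ), 0 < k → k • v ∈ P → v ∈ P)
    {φ : Multiplicative P →* A} {𝔭 : Ideal A} [𝔭.IsPrime] (hreg : IsLogRegularAt P φ 𝔭)
    {e : (Fin n → ℤ) →+ (Fin M → ℤ)} (he : IsSharpEmbedding P (faceMonoid P φ 𝔭) e) :
    ∃ (π : (Fin n → ℤ) →ₗ[ℤ] (Fin n → ℤ)) (d : ℕ) (t : Fin d → Localization.AtPrime 𝔭),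
      DFormData (embMonoid he) (embChart he π) d t ∧
      ∀ p : P, ∃ v : (Localization.AtPrime 𝔭)ˣ,
        embChart he π (embHom he p) * ↑v =
          algebraMap A (Localization.AtPrime 𝔭) (val P φ (p : Fin n → ℤ)) :=
  exists_dformData_of_isLogRegularAt hP hsat hreg he (rank_embMonoid_le he)

end LogChart

end Literature.AlgebraicGeometry.Resolution
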